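import Summits.QuantumFields.YangMills.Theorems.LuscherReductionTwistedTraceScalingConstTube
import Summits.QuantumFields.YangMills.Theorems.FemtoTransferGapSlabGround
import Literature.MathematicalPhysics.QuantumFieldTheory.StrongCouplingActivities
import Mathlib.MeasureTheory.Constructions.Polish.Basic
import Mathlib.MeasureTheory.Measure.Haar.Basic
import HarnessLib

/-!
# EXACT PRODUCT DISINTEGRATION of the a-priori measure along ANY equivariant slow chart: `σ^{⊗E} = σ^{⊗3} ⊗ π` — the slow (one-site) variable of a
# Born–Oppenheimer chart carries ONE-SITE Haar measure with NO Jacobian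
# (lane A of S-BASE, crux `TwistedTraceScaling` stmt-QuantumFields-20203, sub-target C4 INNER; design note `pub/ym-fleet/ym-luscher-20007-p1/COARSE-DESIGN.md` §23)

ABSTRACT SETTING.  A «slow chart» is a continuous injection `Ψ : (one-site configurations) × Y → (L³-lattice configurations)` from a Polish parameter space
`Y` (the transverse = stiff + gauge-linear coordinates) which is EQUIVARIANT: `Ψ (u·v) y = Ψ u y · constLift L v` — the one-site group law is right
multiplication by constant configurations (tree instances: the gnomonic tube `…ConstTube.tubeMap` on balanced coordinates, ★★ `tubeMap_injective`; the
orthographic tube of the sequel, whose slow variable is the polar mean of the links of each direction).  THEN: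
* `slowEmb Ψ (u, y) = Ψ u⁻¹ y` is a MEASURABLE EMBEDDING (continuous injection of a Polish space; `measurableEmbedding_slowEmb`), its range is measurable;
* the pulled-back measure `slowMeasure = comap (slowEmb Ψ) σ^{⊗E}` is invariant under LEFT translations of the one-site variable (★ `map_leftShift_slowMeasure`:
  under the embedding they are RIGHT multiplications by constant configurations, `slowEmb_leftShift`, which preserve the product Haar measure);
* a finite measure on `G × Y` (`G` = one-site configurations, a compact second-countable group) invariant under left translations of `G` is
  `Haar_G ⊗ (marginal)` — fibrewise uniqueness of Haar measure (`MeasureTheory.Measure.haarMeasure_unique`; `eq_smul_configMeasure_one_of_isMulLeftInvariant`)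
  ⇒ ★★ `slowMeasure_prod`, ★★ `slowMeasure_eq_prod`: `slowMeasure = σ^{⊗3} ⊗ slowMarginal`;
* ★★★ `integral_configMeasure_slowChart`: for every bounded measurable `F` vanishing off the range of the chart,
  `∫ F dσ^{⊗E} = ∫ (∫ F(Ψ u y) dσ^{⊗3}(u)) dπ(y)` with `π = slowMarginal Ψ` a finite measure on `Y`, the one-site variable `u` integrated against the
  ONE-SITE a-priori measure `configMeasure SU2 1` EXACTLY.
WHY (design note §23).  Along the slow manifold the lattice kernel is the one-site kernel at coupling `L³β` (`transferKernel_constLift`); with this theorem the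
reference measure in the slow variable is exactly the measure against which the one-site levels `levelValue su2Rep 1 (L³β) k` are defined, so the DIAG and FLOOR
clauses of `InnerBOPackageAt` compare like with like, with no Jacobian in the slow variable — for ANY equivariant chart, whatever its transverse coordinates.
HONEST FRAMING: exact measure-theoretic bookkeeping for a stub of a child of the CONDITIONAL reduction route R2b1; no kernel estimate; C4 OPEN; not infinite
volume, not a gap, not Clay.
-/

set_option autoImplicit false

noncomputable section

open MeasureTheory Filter Topology Real
open scoped BigOperators
open Literature.MathematicalPhysics.QuantumFieldTheory
open Literature.MathematicalPhysics.QuantumLattice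

namespace Summit.QuantumFields.YangMills.Theorems.FemtoTransferGap.TwoLattice.SlowChart

open Summit.QuantumFields.YangMills.Theorems.FemtoTransferGap

variable {L : ℕ} [NeZero L]
variable {Y : Type*} [TopologicalSpace Y] [MeasurableSpace Y]

/-! ## §1 Equivariant slow charts and the measurable embedding `(u, y) ↦ Ψ u⁻¹ y` -/

/-- **The slow embedding** of a chart `Ψ`: `(u, y) ↦ Ψ u⁻¹ y` (the inverse turns the one-site LEFT translation into a RIGHT translation of the image).
[folklore] -/
def slowEmb (Ψ : GaugeConfig 3 1 SU2 → Y → GaugeConfig 3 L SU2) (p : GaugeConfig 3 1 SU2 × Y) : GaugeConfig 3 L SU2 := Ψ p.1⁻¹ p.2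

omit [NeZero L] [MeasurableSpace Y] in
/-- The slow embedding of a jointly continuous chart is continuous. [folklore] -/
theorem continuous_slowEmb {Ψ : GaugeConfig 3 1 SU2 → Y → GaugeConfig 3 L SU2} (hc : Continuous fun p : GaugeConfig 3 1 SU2 × Y => Ψ p.1 p.2) :
    Continuous (slowEmb Ψ) := by
  have h1 : Continuous fun p : GaugeConfig 3 1 SU2 × Y => ((p.1)⁻¹, p.2) := (continuous_fst.inv).prodMk continuous_snd
  exact hc.comp h1

omit [NeZero L] [TopologicalSpace Y] [MeasurableSpace Y] in
/-- The slow embedding of an injective chart is injective. [folklore] -/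
theorem slowEmb_injective {Ψ : GaugeConfig 3 1 SU2 → Y → GaugeConfig 3 L SU2} (hi : Function.Injective fun p : GaugeConfig 3 1 SU2 × Y => Ψ p.1 p.2) :
    Function.Injective (slowEmb Ψ) := by
  intro p q h
  have h' := @hi ((p.1)⁻¹, p.2) ((q.1)⁻¹, q.2) h
  simp only [Prod.mk.injEq, inv_inj] at h'
  exact Prod.ext h'.1 h'.2

/-- `SU(2)` is a Polish space (a compact subset of `ℂ^{2×2}`). [folklore] -/
theorem polishSpace_su2 : PolishSpace SU2 := by
  haveI : PolishSpace (Matrix (Fin 2) (Fin 2) ℂ) := inferInstanceAs (PolishSpace (Fin 2 → Fin 2 → ℂ))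
  exact (continuous_subtype_val.isClosedEmbedding Subtype.val_injective).polishSpace

/-- ★ **The slow embedding of a continuous injective chart on a Polish parameter space is a measurable embedding.** [folklore] -/
theorem measurableEmbedding_slowEmb [PolishSpace Y] [BorelSpace Y] {Ψ : GaugeConfig 3 1 SU2 → Y → GaugeConfig 3 L SU2}
    (hc : Continuous fun p : GaugeConfig 3 1 SU2 × Y => Ψ p.1 p.2) (hi : Function.Injective fun p : GaugeConfig 3 1 SU2 × Y => Ψ p.1 p.2) :
    MeasurableEmbedding (slowEmb Ψ) := by
  haveI : SecondCountableTopology SU2 := secondCountableTopology_su2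
  haveI : PolishSpace SU2 := polishSpace_su2
  exact (continuous_slowEmb hc).measurableEmbedding (slowEmb_injective hi)

omit [NeZero L] [TopologicalSpace Y] [MeasurableSpace Y] in
/-- The range of the slow embedding is the range of the chart. [folklore] -/
theorem range_slowEmb (Ψ : GaugeConfig 3 1 SU2 → Y → GaugeConfig 3 L SU2) :
    Set.range (slowEmb Ψ) = Set.range fun p : GaugeConfig 3 1 SU2 × Y => Ψ p.1 p.2 := by
  ext U
  constructor
  · rintro ⟨p, rfl⟩; exact ⟨((p.1)⁻¹, p.2), rfl⟩
  · rintro ⟨p, rfl⟩; exact ⟨((p.1)⁻¹, p.2), by simp [slowEmb]⟩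

/-! ## §2 The pulled-back measure and its invariance under one-site translations -/

/-- The a-priori measure pulled back along the slow embedding. [folklore] -/
def slowMeasure (Ψ : GaugeConfig 3 1 SU2 → Y → GaugeConfig 3 L SU2) : Measure (GaugeConfig 3 1 SU2 × Y) :=
  Measure.comap (slowEmb Ψ) (configMeasure SU2 L)

/-- Left translation of the one-site variable. [folklore] -/
def leftShift (v : GaugeConfig 3 1 SU2) (p : GaugeConfig 3 1 SU2 × Y) : GaugeConfig 3 1 SU2 × Y := (v * p.1, p.2)

omit [TopologicalSpace Y] in
/-- Left translations are measurable. [folklore] -/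
theorem measurable_leftShift (v : GaugeConfig 3 1 SU2) : Measurable (leftShift (Y := Y) v) :=
  (measurable_fst.const_mul v).prodMk measurable_snd

omit [NeZero L] [TopologicalSpace Y] [MeasurableSpace Y] in
/-- Under the embedding a left translation of `u` is a right multiplication by a constant configuration:
`slowEmb (v·u, y) = slowEmb (u, y) · constLift L v⁻¹` (for an equivariant chart). [folklore] -/
theorem slowEmb_leftShift {Ψ : GaugeConfig 3 1 SU2 → Y → GaugeConfig 3 L SU2}
    (hmul : ∀ (u v : GaugeConfig 3 1 SU2) (y : Y), Ψ (u * v) y = Ψ u y * constLift L v) (v : GaugeConfig 3 1 SU2) (p : GaugeConfig 3 1 SU2 × Y) :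
    slowEmb Ψ (leftShift v p) = slowEmb Ψ p * constLift L v⁻¹ := by
  simp only [slowEmb, leftShift, mul_inv_rev, hmul]

omit [NeZero L] [TopologicalSpace Y] [MeasurableSpace Y] in
/-- The image of a translated set is the right translate of the image. [folklore] -/
theorem image_preimage_leftShift {Ψ : GaugeConfig 3 1 SU2 → Y → GaugeConfig 3 L SU2}
    (hmul : ∀ (u v : GaugeConfig 3 1 SU2) (y : Y), Ψ (u * v) y = Ψ u y * constLift L v) (v : GaugeConfig 3 1 SU2) (s : Set (GaugeConfig 3 1 SU2 × Y)) :
    slowEmb Ψ '' (leftShift v ⁻¹' s) = (fun U : GaugeConfig 3 L SU2 => U * constLift L v⁻¹) ⁻¹' (slowEmb Ψ '' s) := by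
  ext U
  simp only [Set.mem_image, Set.mem_preimage]
  constructor
  · rintro ⟨p, hp, rfl⟩
    exact ⟨leftShift v p, hp, slowEmb_leftShift hmul v p⟩
  · rintro ⟨q, hq, hqU⟩
    refine ⟨leftShift v⁻¹ q, ?_, ?_⟩
    · simpa [leftShift, ← mul_assoc] using hq
    · have h := slowEmb_leftShift hmul v⁻¹ q
      rw [inv_inv, hqU, mul_assoc, ← ConstTube.constLift_mul, inv_mul_cancel, ConstTube.constLift_one', mul_one] at h
      exact h

section Chart

variable [PolishSpace Y] [BorelSpace Y] {Ψ : GaugeConfig 3 1 SU2 → Y → GaugeConfig 3 L SU2}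
  (hc : Continuous fun p : GaugeConfig 3 1 SU2 × Y => Ψ p.1 p.2) (hi : Function.Injective fun p : GaugeConfig 3 1 SU2 × Y => Ψ p.1 p.2)
  (hmul : ∀ (u v : GaugeConfig 3 1 SU2) (y : Y), Ψ (u * v) y = Ψ u y * constLift L v)

include hc hi

/-- `slowMeasure s = σ^{⊗E}(slowEmb '' s)`. [folklore] -/
theorem slowMeasure_apply (s : Set (GaugeConfig 3 1 SU2 × Y)) : slowMeasure Ψ s = configMeasure SU2 L (slowEmb Ψ '' s) :=
  (measurableEmbedding_slowEmb hc hi).comap_apply _ _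

/-- The pulled-back measure is finite (total mass `≤ 1`). [folklore] -/
theorem isFiniteMeasure_slowMeasure : IsFiniteMeasure (slowMeasure Ψ) := by
  refine ⟨?_⟩
  rw [slowMeasure_apply hc hi]
  exact prob_le_one.trans_lt ENNReal.one_lt_top

/-- The pushed-forward pulled-back measure is the a-priori measure restricted to the range of the chart. [folklore] -/
theorem map_slowEmb_slowMeasure : (slowMeasure Ψ).map (slowEmb Ψ) = (configMeasure SU2 L).restrict (Set.range fun p : GaugeConfig 3 1 SU2 × Y => Ψ p.1 p.2) := by
  rw [← range_slowEmb]; exact (measurableEmbedding_slowEmb hc hi).map_comap _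

include hmul

/-- ★ **Invariance**: the pulled-back measure is invariant under left translations of the one-site variable (right invariance of the a-priori measure under
multiplication by constant configurations). [folklore] -/
theorem map_leftShift_slowMeasure (v : GaugeConfig 3 1 SU2) : (slowMeasure Ψ).map (leftShift v) = slowMeasure Ψ := by
  haveI : (configMeasure SU2 L).IsMulRightInvariant := by unfold configMeasure; infer_instance
  ext s hs
  rw [Measure.map_apply (measurable_leftShift v) hs, slowMeasure_apply hc hi, slowMeasure_apply hc hi, image_preimage_leftShift hmul,
    measure_preimage_mul_right]

end Chart

/-- The transverse marginal of a chart. [folklore] -/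
def slowMarginal (Ψ : GaugeConfig 3 1 SU2 → Y → GaugeConfig 3 L SU2) : Measure Y := (slowMeasure Ψ).map Prod.snd

omit [TopologicalSpace Y] in
/-- `slowMarginal A = slowMeasure (univ ×ˢ A)`. [folklore] -/
theorem slowMarginal_apply (Ψ : GaugeConfig 3 1 SU2 → Y → GaugeConfig 3 L SU2) {A : Set Y} (hA : MeasurableSet A) :
    slowMarginal Ψ A = slowMeasure Ψ (Set.univ ×ˢ A) := by
  rw [slowMarginal, Measure.map_apply measurable_snd hA, Set.univ_prod]

/-- The one-site a-priori measure is the Haar probability measure of the compact group of one-site configurations: every finite left-invariant measure on it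
is a multiple, the multiple being the total mass. [folklore] -/
theorem eq_smul_configMeasure_one_of_isMulLeftInvariant (ν : Measure (GaugeConfig 3 1 SU2)) [IsFiniteMeasure ν] [ν.IsMulLeftInvariant] :
    ν = ν Set.univ • configMeasure SU2 1 := by
  haveI : SecondCountableTopology SU2 := secondCountableTopology_su2
  haveI : (configMeasure SU2 1).IsMulLeftInvariant := by unfold configMeasure; infer_instance
  have h1 := Measure.haarMeasure_unique ν (⊤ : TopologicalSpace.PositiveCompacts (GaugeConfig 3 1 SU2))
  have h2 := Measure.haarMeasure_unique (configMeasure SU2 1) (⊤ : TopologicalSpace.PositiveCompacts (GaugeConfig 3 1 SU2))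
  rw [TopologicalSpace.PositiveCompacts.coe_top] at h1 h2
  rw [measure_univ, one_smul] at h2
  rw [← h2] at h1
  exact h1

section Product

variable [PolishSpace Y] [BorelSpace Y] {Ψ : GaugeConfig 3 1 SU2 → Y → GaugeConfig 3 L SU2}
  (hc : Continuous fun p : GaugeConfig 3 1 SU2 × Y => Ψ p.1 p.2) (hi : Function.Injective fun p : GaugeConfig 3 1 SU2 × Y => Ψ p.1 p.2)
  (hmul : ∀ (u v : GaugeConfig 3 1 SU2) (y : Y), Ψ (u * v) y = Ψ u y * constLift L v)

include hc hi

/-- The transverse marginal is finite. [folklore] -/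
theorem isFiniteMeasure_slowMarginal : IsFiniteMeasure (slowMarginal Ψ) := by
  haveI := isFiniteMeasure_slowMeasure hc hi
  unfold slowMarginal; infer_instance

include hmul

/-- ★★ **Product structure on rectangles**: `slowMeasure (B ×ˢ A) = σ^{⊗3}(B) · slowMarginal(A)`. [folklore] -/
theorem slowMeasure_prod {B : Set (GaugeConfig 3 1 SU2)} {A : Set Y} (hB : MeasurableSet B) (hA : MeasurableSet A) :
    slowMeasure Ψ (B ×ˢ A) = configMeasure SU2 1 B * slowMarginal Ψ A := by
  haveI := isFiniteMeasure_slowMeasure hc hi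
  -- the fibre measure `ν_A(B') = slowMeasure (B' ×ˢ A)`
  set νA : Measure (GaugeConfig 3 1 SU2) := ((slowMeasure Ψ).restrict (Set.univ ×ˢ A)).map Prod.fst with hνA
  have hνA_apply : ∀ B' : Set (GaugeConfig 3 1 SU2), MeasurableSet B' → νA B' = slowMeasure Ψ (B' ×ˢ A) := fun B' hB' => by
    rw [hνA, Measure.map_apply measurable_fst hB', Measure.restrict_apply (measurable_fst hB'), ← Set.prod_univ, Set.prod_inter_prod,
      Set.inter_univ, Set.univ_inter]
  haveI : IsFiniteMeasure νA := by rw [hνA]; infer_instance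
  haveI : νA.IsMulLeftInvariant := by
    refine ⟨fun v => ?_⟩
    ext B' hB'
    have hpre : MeasurableSet ((fun u => v * u) ⁻¹' B') := measurable_const_mul v hB'
    rw [Measure.map_apply (measurable_const_mul v) hB', hνA_apply _ hpre, hνA_apply _ hB']
    have hset : ((fun u => v * u) ⁻¹' B') ×ˢ A = leftShift v ⁻¹' (B' ×ˢ A) := by
      ext p; simp [leftShift, Set.mem_prod]
    rw [hset, ← Measure.map_apply (measurable_leftShift v) (hB'.prod hA), map_leftShift_slowMeasure hc hi hmul]
  have h := eq_smul_configMeasure_one_of_isMulLeftInvariant νA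
  have hB1 : slowMeasure Ψ (B ×ˢ A) = νA B := (hνA_apply B hB).symm
  rw [hB1, h, Measure.smul_apply, smul_eq_mul, hνA_apply _ MeasurableSet.univ, ← slowMarginal_apply Ψ hA, mul_comm]

/-- ★★ **EXACT PRODUCT DISINTEGRATION**: `slowMeasure = σ^{⊗3} ⊗ slowMarginal` — in any equivariant chart the a-priori measure is the product of the ONE-SITE
a-priori measure and the transverse marginal. [folklore] -/
theorem slowMeasure_eq_prod : slowMeasure Ψ = (configMeasure SU2 1).prod (slowMarginal Ψ) := by
  haveI := isFiniteMeasure_slowMarginal hc hi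
  exact (Measure.prod_eq fun s t hs ht => slowMeasure_prod hc hi hmul hs ht).symm

/-! ## §3 ★★★ Integration along an equivariant slow chart: one-site Haar in the slow variable, exactly -/

/-- ★★★ **INTEGRATION ALONG AN EQUIVARIANT SLOW CHART**: for every bounded measurable `F` vanishing off the range of the chart,
`∫ F dσ^{⊗E} = ∫ (∫ F(Ψ u y) dσ^{⊗3}(u)) dπ(y)` with `π = slowMarginal Ψ` (finite) and the one-site variable integrated against the ONE-SITE a-priori measure
`configMeasure SU2 1`. [cite: Luscher1983, §3] -/
theorem integral_configMeasure_slowChart {F : GaugeConfig 3 L SU2 → ℝ} (hF : Measurable F) (hb : ∃ C : ℝ, ∀ U, |F U| ≤ C)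
    (h0 : ∀ U, U ∉ Set.range (fun p : GaugeConfig 3 1 SU2 × Y => Ψ p.1 p.2) → F U = 0) :
    ∫ U, F U ∂configMeasure SU2 L = ∫ y, ∫ u, F (Ψ u y) ∂configMeasure SU2 1 ∂slowMarginal Ψ := by
  haveI := isFiniteMeasure_slowMeasure hc hi
  haveI := isFiniteMeasure_slowMarginal hc hi
  haveI : (configMeasure SU2 1).IsInvInvariant := by unfold configMeasure; infer_instance
  obtain ⟨C, hC⟩ := hb
  have hemb := measurableEmbedding_slowEmb hc hi
  -- Step 1: restrict to the range and pull back
  have h1 : ∫ U, F U ∂configMeasure SU2 L = ∫ p, F (slowEmb Ψ p) ∂slowMeasure Ψ := by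
    rw [← setIntegral_eq_integral_of_forall_compl_eq_zero (s := Set.range fun p : GaugeConfig 3 1 SU2 × Y => Ψ p.1 p.2) (μ := configMeasure SU2 L) h0,
      ← map_slowEmb_slowMeasure hc hi, hemb.integral_map]
  -- Step 2: product disintegration and Fubini (transverse variable outside)
  have hint : Integrable (fun p : GaugeConfig 3 1 SU2 × Y => F (slowEmb Ψ p)) ((configMeasure SU2 1).prod (slowMarginal Ψ)) :=
    integrable_of_measurable_abs_le _ (hF.comp hemb.measurable) (C := C) fun p => hC _
  have h2 : ∫ p, F (slowEmb Ψ p) ∂slowMeasure Ψ = ∫ y, ∫ u, F (slowEmb Ψ (u, y)) ∂configMeasure SU2 1 ∂slowMarginal Ψ := by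
    rw [slowMeasure_eq_prod hc hi hmul]
    exact integral_prod_symm (fun p : GaugeConfig 3 1 SU2 × Y => F (slowEmb Ψ p)) hint
  -- Step 3: undo the inverse in the one-site variable (inversion invariance of one-site Haar)
  have h3 : ∀ y : Y, ∫ u, F (slowEmb Ψ (u, y)) ∂configMeasure SU2 1 = ∫ u, F (Ψ u y) ∂configMeasure SU2 1 := fun y =>
    integral_inv_eq_self (fun u : GaugeConfig 3 1 SU2 => F (Ψ u y)) (configMeasure SU2 1)
  rw [h1, h2]
  exact integral_congr_ae (ae_of_all _ fun y => h3 y)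

omit hmul in
/-- The total mass of the transverse marginal is the a-priori measure of the range of the chart (`≤ 1`). [folklore] -/
theorem slowMarginal_univ : slowMarginal Ψ Set.univ = configMeasure SU2 L (Set.range fun p : GaugeConfig 3 1 SU2 × Y => Ψ p.1 p.2) := by
  rw [slowMarginal_apply Ψ MeasurableSet.univ, Set.univ_prod_univ, slowMeasure_apply hc hi, Set.image_univ, range_slowEmb]

omit hmul in
/-- The range of a continuous injective chart on a Polish space is measurable. [folklore] -/
theorem measurableSet_range_chart : MeasurableSet (Set.range fun p : GaugeConfig 3 1 SU2 × Y => Ψ p.1 p.2) := by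
  rw [← range_slowEmb]; exact (measurableEmbedding_slowEmb hc hi).measurableSet_range

end Product

end Summit.QuantumFields.YangMills.Theorems.FemtoTransferGap.TwoLattice.SlowChart

end
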